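import Summits.Ventures.PercRepro.C041SixVec
import Summits.Ventures.PercRepro.C041ZoneIso

/-!
# ROW C-041 — STRAY-VERTEX INVARIANCE: embeddings of abstract zones transport the one-anchor counts, the
six-vector and the zone conjectures (p6, gen 30)

A ZONE EMBEDDING (`ZoneEmb Z Z'`) is an INJECTIVE map of vertices together with bijections of the edges, the `1`-edges
and the `2`-edges commuting with the end maps — a zone isomorphism whose vertex map need not be onto.  The vertices
of `Z'` outside the image are STRAY: since every edge and every mark of `Z'` comes from one of `Z`, they are isolated
and unmarked (`fst_mem_range`, `markSet_subset_range`), so a path of `Z'` starting in the image never leaves it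
(`adj_of_map`, `reflTransGen_of_map`).  Hence, under the induced bijection of states (`ZoneEmb.state`), every reach
from an image set (`mem_reach_iff`), the four mark sets (`mem_Bl_iff`, …), `D` / `D2` (`mem_D_iff`, `mem_D2_iff`),
admissibility (`adm_iff`) and «blue at `K`» for a single anchor (`blueK_iff`) correspond exactly as along an
isomorphism (`C041ZoneIso`); the one-anchor counts agree (`card_Fset`, …, `card_IBset`), so **the six-vector is
invariant under embeddings** (`sixVec_eq`): adding or deleting isolated unmarked vertices changes nothing — the
constructions `pendant` / `glue` (`C041PendantZone`, `C041AnchorGlue`) leave such a vertex behind, and this is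
the lemma that removes it.  Consequences: cone membership, (P), the one-anchor (CS) and the ZONE O-CUBE transfer
along embeddings in both directions (`inCone_iff`, `K4_iff`, `zoneCSConj_iff`, `zoneOCubeConj_iff`).  Every zone
isomorphism is an embedding (`ofIso`).
-/

namespace PercRepro

namespace ZoneZ

open ZoneData Finset TreeClosure

/-- A ZONE EMBEDDING: an injective map of vertices and bijections of edges, `1`-edges and `2`-edges commuting with
the end maps.  The vertices outside the image are isolated and unmarked. -/
structure ZoneEmb {V E T₁ T₂ V' E' T₁' T₂' : Type*} (Z : ZoneData V E T₁ T₂) (Z' : ZoneData V' E' T₁' T₂') where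
  /-- the map of vertices -/
  v : V → V'
  /-- it is injective -/
  inj : Function.Injective v
  /-- the bijection of edges -/
  e : E ≃ E'
  /-- the bijection of `1`-edges -/
  t₁ : T₁ ≃ T₁'
  /-- the bijection of `2`-edges -/
  t₂ : T₂ ≃ T₂'
  /-- the first ends correspond -/
  fst_map : ∀ x, Z'.fst (e x) = v (Z.fst x)
  /-- the second ends correspond -/
  snd_map : ∀ x, Z'.snd (e x) = v (Z.snd x)
  /-- the vertices of the `1`-edges correspond -/
  at₁_map : ∀ x, Z'.at₁ (t₁ x) = v (Z.at₁ x)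
  /-- the vertices of the `2`-edges correspond -/
  at₂_map : ∀ x, Z'.at₂ (t₂ x) = v (Z.at₂ x)

namespace ZoneEmb

variable {V E T₁ T₂ V' E' T₁' T₂' : Type*} {Z : ZoneData V E T₁ T₂} {Z' : ZoneData V' E' T₁' T₂'}

/-- Every zone isomorphism is a zone embedding. -/
def ofIso (ψ : ZoneIso Z Z') : ZoneEmb Z Z' :=
  ⟨ψ.v, ψ.v.injective, ψ.e, ψ.t₁, ψ.t₂, ψ.fst_map, ψ.snd_map, ψ.at₁_map, ψ.at₂_map⟩

/-- The vertex map of the embedding of an isomorphism. -/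
theorem ofIso_v (ψ : ZoneIso Z Z') (u : V) : (ofIso ψ).v u = ψ.v u := rfl

variable (φ : ZoneEmb Z Z')

/-- The induced bijection of states: every colouring transported along the corresponding bijection. -/
def state : State E T₁ T₂ ≃ State E' T₁' T₂' :=
  (Equiv.arrowCongr φ.e (Equiv.refl Bool)).prodCongr
    ((Equiv.arrowCongr φ.t₁ (Equiv.refl Bool)).prodCongr (Equiv.arrowCongr φ.t₂ (Equiv.refl Bool)))

/-- The colour of a transported edge. -/
theorem state_fst (σ : State E T₁ T₂) (x : E) : (φ.state σ).1 (φ.e x) = σ.1 x := by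
  simp [state]

/-- The colour of a transported `1`-edge. -/
theorem state_snd_fst (σ : State E T₁ T₂) (x : T₁) : (φ.state σ).2.1 (φ.t₁ x) = σ.2.1 x := by
  simp [state]

/-- The colour of a transported `2`-edge. -/
theorem state_snd_snd (σ : State E T₁ T₂) (x : T₂) : (φ.state σ).2.2 (φ.t₂ x) = σ.2.2 x := by
  simp [state]

/-! ## Every edge of `Z'` joins image vertices -/

/-- The first end of every edge of `Z'` lies in the image. -/
theorem fst_mem_range (x' : E') : Z'.fst x' ∈ Set.range φ.v :=
  ⟨Z.fst (φ.e.symm x'), by rw [← φ.fst_map, φ.e.apply_symm_apply]⟩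

/-- The second end of every edge of `Z'` lies in the image. -/
theorem snd_mem_range (x' : E') : Z'.snd x' ∈ Set.range φ.v :=
  ⟨Z.snd (φ.e.symm x'), by rw [← φ.snd_map, φ.e.apply_symm_apply]⟩

/-! ## Adjacency and reach -/

/-- Joining transports. -/
theorem joins_iff (x : E) (u w : V) : Z'.Joins (φ.e x) (φ.v u) (φ.v w) ↔ Z.Joins x u w := by
  unfold Joins
  rw [φ.fst_map, φ.snd_map, φ.inj.eq_iff, φ.inj.eq_iff, φ.inj.eq_iff, φ.inj.eq_iff]

/-- Adjacency through edges of a colour transports. -/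
theorem adj_iff (c : Bool) (σ : State E T₁ T₂) (u w : V) :
    Z'.Adj (fun _ b => b = c) (φ.state σ) (φ.v u) (φ.v w) ↔ Z.Adj (fun _ b => b = c) σ u w := by
  unfold Adj
  constructor
  · rintro ⟨x', hj, hc⟩
    refine ⟨φ.e.symm x', ?_, ?_⟩
    · rw [← φ.joins_iff, φ.e.apply_symm_apply]
      exact hj
    · rw [← φ.state_fst, φ.e.apply_symm_apply]
      exact hc
  · rintro ⟨x, hj, hc⟩
    exact ⟨φ.e x, (φ.joins_iff x u w).2 hj, by rw [φ.state_fst]; exact hc⟩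

/-- THE KEY FACT: an adjacency of `Z'` from an image vertex ends in the image and comes from `Z`. -/
theorem adj_of_map (c : Bool) (σ : State E T₁ T₂) {u : V} {w' : V'}
    (h : Z'.Adj (fun _ b => b = c) (φ.state σ) (φ.v u) w') :
    ∃ w, w' = φ.v w ∧ Z.Adj (fun _ b => b = c) σ u w := by
  obtain ⟨x', hj, hc⟩ := h
  obtain ⟨x, rfl⟩ := φ.e.surjective x'
  rw [φ.state_fst] at hc
  rcases hj with ⟨h1, h2⟩ | ⟨h1, h2⟩
  · rw [φ.fst_map] at h1
    rw [φ.snd_map] at h2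
    exact ⟨Z.snd x, h2.symm, x, Or.inl ⟨φ.inj h1, rfl⟩, hc⟩
  · rw [φ.fst_map] at h1
    rw [φ.snd_map] at h2
    exact ⟨Z.fst x, h1.symm, x, Or.inr ⟨rfl, φ.inj h2⟩, hc⟩

/-- Paths transport (forward). -/
theorem reflTransGen_map (c : Bool) (σ : State E T₁ T₂) {u w : V}
    (h : Relation.ReflTransGen (Z.Adj (fun _ b => b = c) σ) u w) :
    Relation.ReflTransGen (Z'.Adj (fun _ b => b = c) (φ.state σ)) (φ.v u) (φ.v w) := by
  induction h with
  | refl => exact Relation.ReflTransGen.refl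
  | tail _ h ih => exact ih.tail ((φ.adj_iff c σ _ _).2 h)

/-- A path of `Z'` from an image vertex stays in the image and comes from a path of `Z`. -/
theorem reflTransGen_of_map (c : Bool) (σ : State E T₁ T₂) {u : V} {w' : V'}
    (h : Relation.ReflTransGen (Z'.Adj (fun _ b => b = c) (φ.state σ)) (φ.v u) w') :
    ∃ w, w' = φ.v w ∧ Relation.ReflTransGen (Z.Adj (fun _ b => b = c) σ) u w := by
  induction h with
  | refl => exact ⟨u, rfl, Relation.ReflTransGen.refl⟩
  | tail _ h ih =>
    obtain ⟨w, rfl, hw⟩ := ih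
    obtain ⟨w₁, rfl, h₁⟩ := φ.adj_of_map c σ h
    exact ⟨w₁, rfl, hw.tail h₁⟩

/-- Reaches transport: an image vertex is reached from the image of `S` iff the vertex is reached from `S`. -/
theorem mem_reach_iff (c : Bool) (σ : State E T₁ T₂) (S : Set V) (u : V) :
    φ.v u ∈ reach (Z'.Adj (fun _ b => b = c) (φ.state σ)) (φ.v '' S) ↔
      u ∈ reach (Z.Adj (fun _ b => b = c) σ) S := by
  constructor
  · rintro ⟨s', ⟨s, hs, rfl⟩, hsu⟩
    obtain ⟨w, hw, hsw⟩ := φ.reflTransGen_of_map c σ hsu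
    rw [φ.inj hw]
    exact ⟨s, hs, hsw⟩
  · rintro ⟨s, hs, hsu⟩
    exact ⟨φ.v s, ⟨s, hs, rfl⟩, φ.reflTransGen_map c σ hsu⟩

/-- A vertex reached from an image set lies in the image. -/
theorem mem_range_of_mem_reach (c : Bool) (σ : State E T₁ T₂) (S : Set V) {w' : V'}
    (h : w' ∈ reach (Z'.Adj (fun _ b => b = c) (φ.state σ)) (φ.v '' S)) : w' ∈ Set.range φ.v := by
  obtain ⟨s', ⟨s, hs, rfl⟩, hsw⟩ := h
  obtain ⟨w, rfl, -⟩ := φ.reflTransGen_of_map c σ hsw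
  exact ⟨w, rfl⟩

/-! ## Marks -/

/-- A mark set transports. -/
theorem mem_markSet_iff {T T' : Type*} (at_ : T → V) (at' : T' → V') (f : T ≃ T')
    (hf : ∀ x, at' (f x) = φ.v (at_ x)) (m : T → Bool) (m' : T' → Bool) (hm : ∀ x, m' (f x) = m x) (b : Bool)
    (u : V) : φ.v u ∈ markSet at' m' b ↔ u ∈ markSet at_ m b := by
  unfold markSet
  constructor
  · rintro ⟨t', ht, hmt⟩
    refine ⟨f.symm t', ?_, ?_⟩
    · apply φ.inj
      rw [← hf, f.apply_symm_apply]
      exact ht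
    · rw [← hm, f.apply_symm_apply]
      exact hmt
  · rintro ⟨t, ht, hmt⟩
    exact ⟨f t, by rw [hf, ht], by rw [hm]; exact hmt⟩

/-- Every mark of `Z'` sits at an image vertex. -/
theorem markSet_subset_range {T T' : Type*} (at_ : T → V) (at' : T' → V') (f : T ≃ T')
    (hf : ∀ x, at' (f x) = φ.v (at_ x)) (m' : T' → Bool) (b : Bool) : markSet at' m' b ⊆ Set.range φ.v := by
  rintro u' ⟨t', ht, -⟩
  exact ⟨at_ (f.symm t'), by rw [← ht, ← hf, f.apply_symm_apply]⟩

/-- The blockers transport. -/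
theorem mem_Bl_iff (σ : State E T₁ T₂) (u : V) : φ.v u ∈ Z'.Bl (φ.state σ) ↔ u ∈ Z.Bl σ :=
  φ.mem_markSet_iff Z.at₁ Z'.at₁ φ.t₁ φ.at₁_map σ.2.1 _ (φ.state_snd_fst σ) false u

/-- The red `1`-marks transport. -/
theorem mem_Blt_iff (σ : State E T₁ T₂) (u : V) : φ.v u ∈ Z'.Blt (φ.state σ) ↔ u ∈ Z.Blt σ :=
  φ.mem_markSet_iff Z.at₁ Z'.at₁ φ.t₁ φ.at₁_map σ.2.1 _ (φ.state_snd_fst σ) true u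

/-- The `2`-blockers transport. -/
theorem mem_M_iff (σ : State E T₁ T₂) (u : V) : φ.v u ∈ Z'.M (φ.state σ) ↔ u ∈ Z.M σ :=
  φ.mem_markSet_iff Z.at₂ Z'.at₂ φ.t₂ φ.at₂_map σ.2.2 _ (φ.state_snd_snd σ) false u

/-- The red `2`-marks transport. -/
theorem mem_Mt_iff (σ : State E T₁ T₂) (u : V) : φ.v u ∈ Z'.Mt (φ.state σ) ↔ u ∈ Z.Mt σ :=
  φ.mem_markSet_iff Z.at₂ Z'.at₂ φ.t₂ φ.at₂_map σ.2.2 _ (φ.state_snd_snd σ) true u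

/-- The blockers of `Z'` lie in the image. -/
theorem Bl_subset_range (σ' : State E' T₁' T₂') : Z'.Bl σ' ⊆ Set.range φ.v :=
  φ.markSet_subset_range Z.at₁ Z'.at₁ φ.t₁ φ.at₁_map σ'.2.1 false

/-- The `2`-blockers of `Z'` lie in the image. -/
theorem M_subset_range (σ' : State E' T₁' T₂') : Z'.M σ' ⊆ Set.range φ.v :=
  φ.markSet_subset_range Z.at₂ Z'.at₂ φ.t₂ φ.at₂_map σ'.2.2 false

/-- A subset of the image characterised pointwise is an image. -/
theorem image_eq_of_forall {S : Set V} {S' : Set V'} (hS : S' ⊆ Set.range φ.v) (h : ∀ u, φ.v u ∈ S' ↔ u ∈ S) :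
    S' = φ.v '' S := by
  ext u'
  constructor
  · intro hu
    obtain ⟨u, rfl⟩ := hS hu
    exact ⟨u, (h u).1 hu, rfl⟩
  · rintro ⟨u, hu, rfl⟩
    exact (h u).2 hu

/-- The blockers of the image state. -/
theorem Bl_state (σ : State E T₁ T₂) : Z'.Bl (φ.state σ) = φ.v '' Z.Bl σ :=
  φ.image_eq_of_forall (φ.Bl_subset_range _) (φ.mem_Bl_iff σ)

/-- The `2`-blockers of the image state. -/
theorem M_state (σ : State E T₁ T₂) : Z'.M (φ.state σ) = φ.v '' Z.M σ :=
  φ.image_eq_of_forall (φ.M_subset_range _) (φ.mem_M_iff σ)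

/-! ## The zone sets -/

/-- The deleted vertices transport. -/
theorem mem_D_iff (σ : State E T₁ T₂) (u : V) : φ.v u ∈ Z'.D (φ.state σ) ↔ u ∈ Z.D σ := by
  unfold D BlueAdj
  rw [φ.Bl_state]
  exact φ.mem_reach_iff false σ _ u

/-- The vertices deleted on side `2` transport. -/
theorem mem_D2_iff (σ : State E T₁ T₂) (u : V) : φ.v u ∈ Z'.D2 (φ.state σ) ↔ u ∈ Z.D2 σ := by
  unfold D2 BlueAdj
  rw [φ.M_state]
  exact φ.mem_reach_iff false σ _ u

/-- Admissibility transports. -/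
theorem adm_iff (σ : State E T₁ T₂) : Z'.adm (φ.state σ) ↔ Z.adm σ := by
  unfold adm
  rw [Set.disjoint_left, Set.disjoint_left]
  constructor
  · intro h m hm hmD
    exact h ((φ.mem_M_iff σ m).2 hm) ((φ.mem_D_iff σ m).2 hmD)
  · intro h m' hm hmD
    obtain ⟨m, rfl⟩ := φ.M_subset_range _ hm
    exact h ((φ.mem_M_iff σ m).1 hm) ((φ.mem_D_iff σ m).1 hmD)

/-- The red reach of a single anchor transports. -/
theorem mem_K_iff (σ : State E T₁ T₂) (k u : V) : φ.v u ∈ Z'.K {φ.v k} (φ.state σ) ↔ u ∈ Z.K {k} σ := by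
  unfold K RedAdj
  rw [← Set.image_singleton]
  exact φ.mem_reach_iff true σ _ u

/-- The red reach of an image anchor lies in the image. -/
theorem K_subset_range (σ : State E T₁ T₂) (k : V) : Z'.K {φ.v k} (φ.state σ) ⊆ Set.range φ.v := by
  intro w' hw
  unfold K RedAdj at hw
  rw [← Set.image_singleton] at hw
  exact φ.mem_range_of_mem_reach true σ _ hw

/-- «Blue at `K`» for a single anchor transports. -/
theorem blueK_iff (σ : State E T₁ T₂) (k : V) : Z'.blueK {φ.v k} (φ.state σ) ↔ Z.blueK {k} σ := by
  unfold blueK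
  rw [Set.disjoint_left, Set.disjoint_left]
  constructor
  · intro h u hu hum
    refine h ((φ.mem_K_iff σ k u).2 hu) ?_
    rcases hum with h1 | h2
    · exact Or.inl ((φ.mem_Blt_iff σ u).2 h1)
    · exact Or.inr ((φ.mem_Mt_iff σ u).2 h2)
  · intro h u' hu hum
    obtain ⟨u, rfl⟩ := φ.K_subset_range σ k hu
    refine h ((φ.mem_K_iff σ k u).1 hu) ?_
    rcases hum with h1 | h2
    · exact Or.inl ((φ.mem_Blt_iff σ u).1 h1)
    · exact Or.inr ((φ.mem_Mt_iff σ u).1 h2)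

/-! ## The one-anchor counts, the six-vector and the conjectures -/

section Counts

variable [Fintype E] [DecidableEq E] [Fintype T₁] [DecidableEq T₁] [Fintype T₂] [DecidableEq T₂]
  [Fintype E'] [DecidableEq E'] [Fintype T₁'] [DecidableEq T₁'] [Fintype T₂'] [DecidableEq T₂'] (k : V)

/-- `#F` transports. -/
theorem card_Fset : #(Z'.Fset (φ.v k)) = #(Z.Fset k) := by
  symm
  refine Finset.card_equiv φ.state fun σ => ?_
  rw [mem_Fset, mem_Fset, φ.adm_iff, φ.mem_D_iff, φ.mem_D2_iff]

/-- `#T₁` transports. -/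
theorem card_T1set : #(Z'.T1set (φ.v k)) = #(Z.T1set k) := by
  symm
  refine Finset.card_equiv φ.state fun σ => ?_
  rw [mem_T1set, mem_T1set, φ.adm_iff, φ.mem_D_iff]

/-- `#T₂` transports. -/
theorem card_T2set : #(Z'.T2set (φ.v k)) = #(Z.T2set k) := by
  symm
  refine Finset.card_equiv φ.state fun σ => ?_
  rw [mem_T2set, mem_T2set, φ.adm_iff, φ.mem_D2_iff]

/-- `#I` transports. -/
theorem card_Iset : #(Z'.Iset (φ.v k)) = #(Z.Iset k) := by
  symm
  refine Finset.card_equiv φ.state fun σ => ?_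
  rw [mem_Iset, mem_Iset, φ.adm_iff, φ.blueK_iff]

/-- `#(F + T₁)` transports. -/
theorem card_FAset : #(Z'.FAset (φ.v k)) = #(Z.FAset k) := by
  symm
  refine Finset.card_equiv φ.state fun σ => ?_
  rw [mem_FAset, mem_FAset, φ.adm_iff, φ.mem_D2_iff]

/-- `#(F + T₂)` transports. -/
theorem card_FBset : #(Z'.FBset (φ.v k)) = #(Z.FBset k) := by
  symm
  refine Finset.card_equiv φ.state fun σ => ?_
  rw [mem_FBset, mem_FBset, φ.adm_iff, φ.mem_D_iff]

/-- `#I_F` transports. -/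
theorem card_IFset : #(Z'.IFset (φ.v k)) = #(Z.IFset k) := by
  symm
  refine Finset.card_equiv φ.state fun σ => ?_
  rw [mem_IFset, mem_IFset, φ.adm_iff, φ.blueK_iff, φ.mem_D_iff, φ.mem_D2_iff]

/-- `#(I_F + I₁)` transports. -/
theorem card_IAset : #(Z'.IAset (φ.v k)) = #(Z.IAset k) := by
  symm
  refine Finset.card_equiv φ.state fun σ => ?_
  rw [mem_IAset, mem_IAset, φ.adm_iff, φ.blueK_iff, φ.mem_D2_iff]

/-- `#(I_F + I₂)` transports. -/
theorem card_IBset : #(Z'.IBset (φ.v k)) = #(Z.IBset k) := by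
  symm
  refine Finset.card_equiv φ.state fun σ => ?_
  rw [mem_IBset, mem_IBset, φ.adm_iff, φ.blueK_iff, φ.mem_D_iff]

/-- **STRAY-VERTEX INVARIANCE: the six-vector is invariant under zone embeddings** — isolated unmarked vertices
do not change it. -/
theorem sixVec_eq : Z'.sixVec (φ.v k) = Z.sixVec k := by
  unfold sixVec
  rw [φ.card_Fset, φ.card_FAset, φ.card_FBset, φ.card_IFset, φ.card_IAset, φ.card_IBset]

/-- Cone membership of the six-vector transfers along a zone embedding (both directions). -/
theorem inCone_iff : InCone (Z'.sixVec (φ.v k)) ↔ InCone (Z.sixVec k) := by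
  rw [φ.sixVec_eq]

/-- (P) transfers along a zone embedding (both directions). -/
theorem K4_iff :
    K4 (#(Z'.Fset (φ.v k)) : ℝ) (#(Z'.T1set (φ.v k))) (#(Z'.T2set (φ.v k))) (#(Z'.Iset (φ.v k))) ↔
      K4 (#(Z.Fset k) : ℝ) (#(Z.T1set k)) (#(Z.T2set k)) (#(Z.Iset k)) := by
  rw [φ.card_Fset, φ.card_T1set, φ.card_T2set, φ.card_Iset]

/-- The one-anchor ZONE (CS) transfers along a zone embedding (both directions). -/
theorem zoneCSConj_iff : Z'.ZoneCSConj {φ.v k} (∅ : Set V') ↔ Z.ZoneCSConj {k} (∅ : Set V) := by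
  rw [zoneCSConj_single_iff, zoneCSConj_single_iff, φ.card_Fset, φ.card_T1set, φ.card_T2set, φ.card_Iset]

/-- The one-anchor ZONE O-CUBE transfers along a zone embedding (both directions). -/
theorem zoneOCubeConj_iff : Z'.ZoneOCubeConj {φ.v k} (∅ : Set V') ↔ Z.ZoneOCubeConj {k} (∅ : Set V) := by
  rw [zoneOCubeConj_single_iff, zoneOCubeConj_single_iff, φ.card_Fset, φ.card_T1set, φ.card_T2set, φ.card_Iset]

end Counts

end ZoneEmb

end ZoneZ

end PercRepro
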